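import Summits.Ventures.CertifiedManyBodySolver.Certificates.S2Rm2uTierP.Head
import Summits.Ventures.CertifiedManyBodySolver.Certificates.S2Rm2uTierP.Hints019
import Summits.Ventures.CertifiedManyBodySolver.Rows.CorrWindowCertKernelChainQuotAdjFastBox

/-!
# tier-P instance (S2Rm2u-R13-W3) — chain forest segment 74 of 103 (steps 245..247 from `[]`), file 1 of 1: steps 245..247 (topology (B): eval%-chained accumulators, import-serial INSIDE the segment only)

Generated by hubbard-algo-p2's untrusted exporter (emit_v0.py + emit_w3.py); every datum below is re-derived / re-checked by the kernel chain
(`stepEQA`, Rows/CorrWindowCertKernelChainQuotAdj.lean) or is inert. HONEST FRAMING (xx1): instance data / kernel replay of a CONTROL/CALIBRATION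
certificate (S2′-Rm2-u″ OVERHANG pinned spoke of the La214-E t′-pair {S2′ −357/740, hub′ −3/10}: t′ = −357/740, CORNER objective t′_X = −3/10, eom multipliers PINNED to the hub-Rm2-u′ certificate (EB by name), sdp-1 (R1) C-edition j326976, 4^40-dyadic two-level Gram factors); nothing here is a theorem about the Hubbard model; no summit statement. [cite: Han2020Bootstrap, §3]
-/

set_option linter.style.longLine false
set_option maxRecDepth 100000
set_option maxHeartbeats 0

namespace Summit.Ventures.CertifiedManyBodySolver
namespace CARPolyWindow.TierP.S2Rm2u
open Summit.Ventures.CertifiedQuantumChemistry Summit.Ventures.CertifiedQuantumChemistry.CARPoly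
open Literature.MathematicalPhysics.QuantumLattice Literature.MathematicalPhysics.QuantumLattice.HubbardWave0
open Literature.Probability.LatticeModels
open CARPolyWindow CARPolyWindow.BoxGeom

/-- segment 74 starts from the EMPTY accumulator before step 245 (chain forest, R-g4-11 (L6)). [folklore] -/
def C74_0 : SOSDual.EncPoly := []

/-- accumulator after step 246 within segment 74 (evaluated at elaboration; the kernel re-derives it in `step_245`). [folklore] -/
def C74_1 : SOSDual.EncPoly := eval% stepEQA D 2048 C74_0 (slices.getD 245 []) (hintsOfCodes Dr reps HC245)

/-- KERNEL FACT, step 245 of 350 (fast step (L7): `stepEQAFB_kernel`, box edition). [folklore] -/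
theorem step_245 : C74_1 = stepEQA D 2048 C74_0 (slices.getD 245 []) (hintsOfCodes Dr reps HC245) :=
  stepEQAFB_kernel 6 13 7 rfl (by decide +kernel)

/-- accumulator after step 247 within segment 74 (evaluated at elaboration; the kernel re-derives it in `step_246`). [folklore] -/
def C74_2 : SOSDual.EncPoly := eval% stepEQA D 2048 C74_1 (slices.getD 246 []) (hintsOfCodes Dr reps HC246)

/-- KERNEL FACT, step 246 of 350 (fast step (L7): `stepEQAFB_kernel`, box edition). [folklore] -/
theorem step_246 : C74_2 = stepEQA D 2048 C74_1 (slices.getD 246 []) (hintsOfCodes Dr reps HC246) :=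
  stepEQAFB_kernel 6 13 7 rfl (by decide +kernel)

/-- accumulator after step 248 within segment 74 (evaluated at elaboration; the kernel re-derives it in `step_247`). [folklore] -/
def C74_3 : SOSDual.EncPoly := eval% stepEQA D 2048 C74_2 (slices.getD 247 []) (hintsOfCodes Dr reps HC247)

/-- KERNEL FACT, step 247 of 350 (fast step (L7): `stepEQAFB_kernel`, box edition). [folklore] -/
theorem step_247 : C74_3 = stepEQA D 2048 C74_2 (slices.getD 247 []) (hintsOfCodes Dr reps HC247) :=
  stepEQAFB_kernel 6 13 7 rfl (by decide +kernel)


end CARPolyWindow.TierP.S2Rm2u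
end Summit.Ventures.CertifiedManyBodySolver
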